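import Summits.Ventures.PercRepro.S2DirectCell
import Summits.Ventures.PercRepro.S2FlatSharp
import Summits.Ventures.PercRepro.S2TailFlats
import Summits.Ventures.PercRepro.S2ThirteenSixSpreadNine
import Summits.Ventures.PercRepro.RankLevelSetPlaneTenPrime
import Summits.Ventures.PercRepro.S2ElevenEightK2NuSix
import Summits.Ventures.PercRepro.S2LPPhi

/-!
# PercRepro — S2: THE KEY CELLS `(11, d)`, `68 ≤ d ≤ 74` — THE ROW `p = 11` WITHOUT SUB-CELLS (p7, gen 20; sub-claim S2)

For each corank `d` here, `RLS M 11 5` on every `e`-free core of rank `11` on `11 + d` points (coloops allowed, no coloop split): the flat-sharp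
lever `topCount_le_flat_sharp` at the universal core bounds `(19, 10)` on the plain caps `cq3 d / avgChain16 d / avgChain5b d`, the tail by flats
at `(19, 10)`, and the KEY inequality `Φ(11, 5)·U + A ≤ Σ_{s=6}^{10} C(n, s)` (`c025_core_five_cell_key`, S2DirectCell; `Φ(11, 5) = 1991 / 168`,
`S2LP.phiK_eleven_five`) — one numeral per cell (ratios `0.500`, `0.475`, `0.453`, `0.431`, `0.411`, `0.392`, `0.374`). The mirror of the row `p = 13` key cells
(S2ThirteenKeyCellsA/B, gen 19) at `p = 11`. Nothing about the window is claimed. Axioms: standard.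
-/

open scoped Matroid

namespace PercRepro

namespace ThmN

open Set

variable {α : Type}

set_option maxRecDepth 8192 in
/-- **The key cell `(11, 68)`**: `RLS M 11 5` on every `e`-free core of rank `11` on `79` points (caps `2346 / 148143 / 7589433`; `#U ≤ 622722062946303436436409 / 9556831183900`,
`#{r ≤ 5} ≤ 1870537172080350497624167 / 28670493551700`, `Σ_{s=6}^{10} C(79, s) = 1675757609955`; ratio `0.500`). -/
theorem c025_eleven_key_68 (M : Matroid α) [M.Finite]
    (hR : M.eRank = ((11 : ℕ) : ℕ∞)) (hn : M.E.ncard = 11 + 68)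
    (hfree : ∀ e ∈ M.E, ∃ A ⊆ M.E \ {e}, e ∉ M.closure A ∧ e ∉ M.closure ((M.E \ {e}) \ A)) : RLS M 11 5 := by
  classical
  have hd : M.E.encard = M.eRank + ((68 : ℕ) : ℕ∞) := by
    rw [hR, ← M.ground_finite.cast_ncard_eq, hn]
    push_cast
    ring
  have hs3 := TriangleCap.core_ncard_triangles_le_cq3 M hfree hd
  rw [show TriangleCap.cq3 68 = 2346 by decide] at hs3
  have hs4 := ncard_fourCircuits_le_avgChain16 68 M hfree hd
  rw [show avgChain16 68 = 148143 by decide] at hs4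
  have hs5 := S1.ncard_fiveCircuits_le_avgChain5b 68 M hfree hd
  rw [show S1.avgChain5b 68 = 7589433 by decide] at hs5
  have hflat : ∀ X ⊆ M.E, M.eRk X ≤ 5 → X.ncard ≤ 19 := fun X hX hr => ncard_le_nineteen_of_eRk_le_five_of_free M hfree hX hr
  have hflat' : ∀ X ⊆ M.E, M.eRk X ≤ 4 → X.ncard ≤ 10 := fun X hX hr => ncard_le_ten_of_eRk_le_four_of_free M hfree hX hr
  have hU := topCount_le_flat_sharp M 11 68 (by norm_num) (by norm_num) hR hn hfree 19 10 hflat hflat' (by norm_num) (by norm_num)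
    2346 148143 7589433 hs3 hs4 hs5
  have hA := ncard_eRk_le_five_le_flats M 11 68 (by norm_num) hR hn hfree 19 10 hflat hflat' (by norm_num) (by norm_num)
    (by norm_num) (by norm_num) 2346 148143 7589433 hs3 hs4 hs5
  rw [RLS_iff]
  refine c025_core_five_cell_key M 11 68 hn _ hU _ hA (phiK 11 5) (by rw [S2LP.phiK_eleven_five]; norm_num) ?_
  rw [S2LP.phiK_eleven_five]
  norm_num [Finset.sum_range_succ, Finset.sum_Icc_succ_top, Nat.choose]

set_option maxRecDepth 8192 in
/-- **The key cell `(11, 69)`**: `RLS M 11 5` on every `e`-free core of rank `11` on `80` points (caps `2415 / 156608 / 8139391`; `#U ≤ 155881715586566096353901 / 2205422580900`,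
`#{r ≤ 5} ≤ 156076264218707223538591 / 2205422580900`, `Σ_{s=6}^{10} C(80, s) = 1910857161070`; ratio `0.475`). -/
theorem c025_eleven_key_69 (M : Matroid α) [M.Finite]
    (hR : M.eRank = ((11 : ℕ) : ℕ∞)) (hn : M.E.ncard = 11 + 69)
    (hfree : ∀ e ∈ M.E, ∃ A ⊆ M.E \ {e}, e ∉ M.closure A ∧ e ∉ M.closure ((M.E \ {e}) \ A)) : RLS M 11 5 := by
  classical
  have hd : M.E.encard = M.eRank + ((69 : ℕ) : ℕ∞) := by
    rw [hR, ← M.ground_finite.cast_ncard_eq, hn]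
    push_cast
    ring
  have hs3 := TriangleCap.core_ncard_triangles_le_cq3 M hfree hd
  rw [show TriangleCap.cq3 69 = 2415 by decide] at hs3
  have hs4 := ncard_fourCircuits_le_avgChain16 69 M hfree hd
  rw [show avgChain16 69 = 156608 by decide] at hs4
  have hs5 := S1.ncard_fiveCircuits_le_avgChain5b 69 M hfree hd
  rw [show S1.avgChain5b 69 = 8139391 by decide] at hs5
  have hflat : ∀ X ⊆ M.E, M.eRk X ≤ 5 → X.ncard ≤ 19 := fun X hX hr => ncard_le_nineteen_of_eRk_le_five_of_free M hfree hX hr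
  have hflat' : ∀ X ⊆ M.E, M.eRk X ≤ 4 → X.ncard ≤ 10 := fun X hX hr => ncard_le_ten_of_eRk_le_four_of_free M hfree hX hr
  have hU := topCount_le_flat_sharp M 11 69 (by norm_num) (by norm_num) hR hn hfree 19 10 hflat hflat' (by norm_num) (by norm_num)
    2415 156608 8139391 hs3 hs4 hs5
  have hA := ncard_eRk_le_five_le_flats M 11 69 (by norm_num) hR hn hfree 19 10 hflat hflat' (by norm_num) (by norm_num)
    (by norm_num) (by norm_num) 2415 156608 8139391 hs3 hs4 hs5
  rw [RLS_iff]
  refine c025_core_five_cell_key M 11 69 hn _ hU _ hA (phiK 11 5) (by rw [S2LP.phiK_eleven_five]; norm_num) ?_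
  rw [S2LP.phiK_eleven_five]
  norm_num [Finset.sum_range_succ, Finset.sum_Icc_succ_top, Nat.choose]

set_option maxRecDepth 8192 in
/-- **The key cell `(11, 70)`**: `RLS M 11 5` on every `e`-free core of rank `11` on `81` points (caps `2485 / 165430 / 8720776`; `#U ≤ 3293664778020931565057867 / 43005740327550`,
`#{r ≤ 5} ≤ 1648854076695369192324706 / 21502870163775`, `Σ_{s=6}^{10} C(81, s) = 2175246252036`; ratio `0.453`). -/
theorem c025_eleven_key_70 (M : Matroid α) [M.Finite]
    (hR : M.eRank = ((11 : ℕ) : ℕ∞)) (hn : M.E.ncard = 11 + 70)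
    (hfree : ∀ e ∈ M.E, ∃ A ⊆ M.E \ {e}, e ∉ M.closure A ∧ e ∉ M.closure ((M.E \ {e}) \ A)) : RLS M 11 5 := by
  classical
  have hd : M.E.encard = M.eRank + ((70 : ℕ) : ℕ∞) := by
    rw [hR, ← M.ground_finite.cast_ncard_eq, hn]
    push_cast
    ring
  have hs3 := TriangleCap.core_ncard_triangles_le_cq3 M hfree hd
  rw [show TriangleCap.cq3 70 = 2485 by decide] at hs3
  have hs4 := ncard_fourCircuits_le_avgChain16 70 M hfree hd
  rw [show avgChain16 70 = 165430 by decide] at hs4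
  have hs5 := S1.ncard_fiveCircuits_le_avgChain5b 70 M hfree hd
  rw [show S1.avgChain5b 70 = 8720776 by decide] at hs5
  have hflat : ∀ X ⊆ M.E, M.eRk X ≤ 5 → X.ncard ≤ 19 := fun X hX hr => ncard_le_nineteen_of_eRk_le_five_of_free M hfree hX hr
  have hflat' : ∀ X ⊆ M.E, M.eRk X ≤ 4 → X.ncard ≤ 10 := fun X hX hr => ncard_le_ten_of_eRk_le_four_of_free M hfree hX hr
  have hU := topCount_le_flat_sharp M 11 70 (by norm_num) (by norm_num) hR hn hfree 19 10 hflat hflat' (by norm_num) (by norm_num)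
    2485 165430 8720776 hs3 hs4 hs5
  have hA := ncard_eRk_le_five_le_flats M 11 70 (by norm_num) hR hn hfree 19 10 hflat hflat' (by norm_num) (by norm_num)
    (by norm_num) (by norm_num) 2485 165430 8720776 hs3 hs4 hs5
  rw [RLS_iff]
  refine c025_core_five_cell_key M 11 70 hn _ hU _ hA (phiK 11 5) (by rw [S2LP.phiK_eleven_five]; norm_num) ?_
  rw [S2LP.phiK_eleven_five]
  norm_num [Finset.sum_range_succ, Finset.sum_Icc_succ_top, Nat.choose]

set_option maxRecDepth 8192 in
/-- **The key cell `(11, 71)`**: `RLS M 11 5` on every `e`-free core of rank `11` on `82` points (caps `2556 / 174620 / 9334915`; `#U ≤ 7130155355971034259410621 / 86011480655100`,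
`#{r ≤ 5} ≤ 793196372783003996287379 / 9556831183900`, `Σ_{s=6}^{10} C(82, s) = 2472125718348`; ratio `0.431`). -/
theorem c025_eleven_key_71 (M : Matroid α) [M.Finite]
    (hR : M.eRank = ((11 : ℕ) : ℕ∞)) (hn : M.E.ncard = 11 + 71)
    (hfree : ∀ e ∈ M.E, ∃ A ⊆ M.E \ {e}, e ∉ M.closure A ∧ e ∉ M.closure ((M.E \ {e}) \ A)) : RLS M 11 5 := by
  classical
  have hd : M.E.encard = M.eRank + ((71 : ℕ) : ℕ∞) := by
    rw [hR, ← M.ground_finite.cast_ncard_eq, hn]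
    push_cast
    ring
  have hs3 := TriangleCap.core_ncard_triangles_le_cq3 M hfree hd
  rw [show TriangleCap.cq3 71 = 2556 by decide] at hs3
  have hs4 := ncard_fourCircuits_le_avgChain16 71 M hfree hd
  rw [show avgChain16 71 = 174620 by decide] at hs4
  have hs5 := S1.ncard_fiveCircuits_le_avgChain5b 71 M hfree hd
  rw [show S1.avgChain5b 71 = 9334915 by decide] at hs5
  have hflat : ∀ X ⊆ M.E, M.eRk X ≤ 5 → X.ncard ≤ 19 := fun X hX hr => ncard_le_nineteen_of_eRk_le_five_of_free M hfree hX hr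
  have hflat' : ∀ X ⊆ M.E, M.eRk X ≤ 4 → X.ncard ≤ 10 := fun X hX hr => ncard_le_ten_of_eRk_le_four_of_free M hfree hX hr
  have hU := topCount_le_flat_sharp M 11 71 (by norm_num) (by norm_num) hR hn hfree 19 10 hflat hflat' (by norm_num) (by norm_num)
    2556 174620 9334915 hs3 hs4 hs5
  have hA := ncard_eRk_le_five_le_flats M 11 71 (by norm_num) hR hn hfree 19 10 hflat hflat' (by norm_num) (by norm_num)
    (by norm_num) (by norm_num) 2556 174620 9334915 hs3 hs4 hs5
  rw [RLS_iff]
  refine c025_core_five_cell_key M 11 71 hn _ hU _ hA (phiK 11 5) (by rw [S2LP.phiK_eleven_five]; norm_num) ?_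
  rw [S2LP.phiK_eleven_five]
  norm_num [Finset.sum_range_succ, Finset.sum_Icc_succ_top, Nat.choose]

set_option maxRecDepth 8192 in
/-- **The key cell `(11, 72)`**: `RLS M 11 5` on every `e`-free core of rank `11` on `83` points (caps `2628 / 184188 / 9983172`; `#U ≤ 642479448981377678788108 / 7167623387925`,
`#{r ≤ 5} ≤ 214414375526483317284096 / 2389207795975`, `Σ_{s=6}^{10} C(83, s) = 2804998480362`; ratio `0.411`). -/
theorem c025_eleven_key_72 (M : Matroid α) [M.Finite]
    (hR : M.eRank = ((11 : ℕ) : ℕ∞)) (hn : M.E.ncard = 11 + 72)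
    (hfree : ∀ e ∈ M.E, ∃ A ⊆ M.E \ {e}, e ∉ M.closure A ∧ e ∉ M.closure ((M.E \ {e}) \ A)) : RLS M 11 5 := by
  classical
  have hd : M.E.encard = M.eRank + ((72 : ℕ) : ℕ∞) := by
    rw [hR, ← M.ground_finite.cast_ncard_eq, hn]
    push_cast
    ring
  have hs3 := TriangleCap.core_ncard_triangles_le_cq3 M hfree hd
  rw [show TriangleCap.cq3 72 = 2628 by decide] at hs3
  have hs4 := ncard_fourCircuits_le_avgChain16 72 M hfree hd
  rw [show avgChain16 72 = 184188 by decide] at hs4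
  have hs5 := S1.ncard_fiveCircuits_le_avgChain5b 72 M hfree hd
  rw [show S1.avgChain5b 72 = 9983172 by decide] at hs5
  have hflat : ∀ X ⊆ M.E, M.eRk X ≤ 5 → X.ncard ≤ 19 := fun X hX hr => ncard_le_nineteen_of_eRk_le_five_of_free M hfree hX hr
  have hflat' : ∀ X ⊆ M.E, M.eRk X ≤ 4 → X.ncard ≤ 10 := fun X hX hr => ncard_le_ten_of_eRk_le_four_of_free M hfree hX hr
  have hU := topCount_le_flat_sharp M 11 72 (by norm_num) (by norm_num) hR hn hfree 19 10 hflat hflat' (by norm_num) (by norm_num)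
    2628 184188 9983172 hs3 hs4 hs5
  have hA := ncard_eRk_le_five_le_flats M 11 72 (by norm_num) hR hn hfree 19 10 hflat hflat' (by norm_num) (by norm_num)
    (by norm_num) (by norm_num) 2628 184188 9983172 hs3 hs4 hs5
  rw [RLS_iff]
  refine c025_core_five_cell_key M 11 72 hn _ hU _ hA (phiK 11 5) (by rw [S2LP.phiK_eleven_five]; norm_num) ?_
  rw [S2LP.phiK_eleven_five]
  norm_num [Finset.sum_range_succ, Finset.sum_Icc_succ_top, Nat.choose]

set_option maxRecDepth 8192 in
/-- **The key cell `(11, 73)`**: `RLS M 11 5` on every `e`-free core of rank `11` on `84` points (caps `2701 / 194144 / 10666950`; `#U ≤ 7210465028801008175449 / 74468814420`,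
`#{r ≤ 5} ≤ 21656704590212029481887 / 223406443260`, `Σ_{s=6}^{10} C(84, s) = 3177693665550`; ratio `0.392`). -/
theorem c025_eleven_key_73 (M : Matroid α) [M.Finite]
    (hR : M.eRank = ((11 : ℕ) : ℕ∞)) (hn : M.E.ncard = 11 + 73)
    (hfree : ∀ e ∈ M.E, ∃ A ⊆ M.E \ {e}, e ∉ M.closure A ∧ e ∉ M.closure ((M.E \ {e}) \ A)) : RLS M 11 5 := by
  classical
  have hd : M.E.encard = M.eRank + ((73 : ℕ) : ℕ∞) := by
    rw [hR, ← M.ground_finite.cast_ncard_eq, hn]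
    push_cast
    ring
  have hs3 := TriangleCap.core_ncard_triangles_le_cq3 M hfree hd
  rw [show TriangleCap.cq3 73 = 2701 by decide] at hs3
  have hs4 := ncard_fourCircuits_le_avgChain16 73 M hfree hd
  rw [show avgChain16 73 = 194144 by decide] at hs4
  have hs5 := S1.ncard_fiveCircuits_le_avgChain5b 73 M hfree hd
  rw [show S1.avgChain5b 73 = 10666950 by decide] at hs5
  have hflat : ∀ X ⊆ M.E, M.eRk X ≤ 5 → X.ncard ≤ 19 := fun X hX hr => ncard_le_nineteen_of_eRk_le_five_of_free M hfree hX hr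
  have hflat' : ∀ X ⊆ M.E, M.eRk X ≤ 4 → X.ncard ≤ 10 := fun X hX hr => ncard_le_ten_of_eRk_le_four_of_free M hfree hX hr
  have hU := topCount_le_flat_sharp M 11 73 (by norm_num) (by norm_num) hR hn hfree 19 10 hflat hflat' (by norm_num) (by norm_num)
    2701 194144 10666950 hs3 hs4 hs5
  have hA := ncard_eRk_le_five_le_flats M 11 73 (by norm_num) hR hn hfree 19 10 hflat hflat' (by norm_num) (by norm_num)
    (by norm_num) (by norm_num) 2701 194144 10666950 hs3 hs4 hs5
  rw [RLS_iff]
  refine c025_core_five_cell_key M 11 73 hn _ hU _ hA (phiK 11 5) (by rw [S2LP.phiK_eleven_five]; norm_num) ?_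
  rw [S2LP.phiK_eleven_five]
  norm_num [Finset.sum_range_succ, Finset.sum_Icc_succ_top, Nat.choose]

set_option maxRecDepth 8192 in
/-- **The key cell `(11, 74)`**: `RLS M 11 5` on every `e`-free core of rank `11` on `85` points (caps `2775 / 204498 / 11387689`; `#U ≤ 39943090174299932229495 / 382273247356`,
`#{r ≤ 5} ≤ 1799509681095479817645011 / 17202296131020`, `Σ_{s=6}^{10} C(85, s) = 3594392315496`; ratio `0.374`). -/
theorem c025_eleven_key_74 (M : Matroid α) [M.Finite]
    (hR : M.eRank = ((11 : ℕ) : ℕ∞)) (hn : M.E.ncard = 11 + 74)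
    (hfree : ∀ e ∈ M.E, ∃ A ⊆ M.E \ {e}, e ∉ M.closure A ∧ e ∉ M.closure ((M.E \ {e}) \ A)) : RLS M 11 5 := by
  classical
  have hd : M.E.encard = M.eRank + ((74 : ℕ) : ℕ∞) := by
    rw [hR, ← M.ground_finite.cast_ncard_eq, hn]
    push_cast
    ring
  have hs3 := TriangleCap.core_ncard_triangles_le_cq3 M hfree hd
  rw [show TriangleCap.cq3 74 = 2775 by decide] at hs3
  have hs4 := ncard_fourCircuits_le_avgChain16 74 M hfree hd
  rw [show avgChain16 74 = 204498 by decide] at hs4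
  have hs5 := S1.ncard_fiveCircuits_le_avgChain5b 74 M hfree hd
  rw [show S1.avgChain5b 74 = 11387689 by decide] at hs5
  have hflat : ∀ X ⊆ M.E, M.eRk X ≤ 5 → X.ncard ≤ 19 := fun X hX hr => ncard_le_nineteen_of_eRk_le_five_of_free M hfree hX hr
  have hflat' : ∀ X ⊆ M.E, M.eRk X ≤ 4 → X.ncard ≤ 10 := fun X hX hr => ncard_le_ten_of_eRk_le_four_of_free M hfree hX hr
  have hU := topCount_le_flat_sharp M 11 74 (by norm_num) (by norm_num) hR hn hfree 19 10 hflat hflat' (by norm_num) (by norm_num)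
    2775 204498 11387689 hs3 hs4 hs5
  have hA := ncard_eRk_le_five_le_flats M 11 74 (by norm_num) hR hn hfree 19 10 hflat hflat' (by norm_num) (by norm_num)
    (by norm_num) (by norm_num) 2775 204498 11387689 hs3 hs4 hs5
  rw [RLS_iff]
  refine c025_core_five_cell_key M 11 74 hn _ hU _ hA (phiK 11 5) (by rw [S2LP.phiK_eleven_five]; norm_num) ?_
  rw [S2LP.phiK_eleven_five]
  norm_num [Finset.sum_range_succ, Finset.sum_Icc_succ_top, Nat.choose]


end ThmN

end PercRepro
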